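import Literature.AnabelianGeometry.EtaleTheta.TemperedFrobenioid
import Literature.AnabelianGeometry.EtaleTheta.SubmonoidPerfection

/-!
# [EtTh] §3: Remark 3.6.4 (perfection clause, group-saturation) — proof

Mochizuki, *The étale theta function …*, Publ. RIMS **45** (2009), §3, Remark 3.6.4, PRIMS PDF p. 79
(printed 305) [cite: MochizukiEtTh2009, Rmk 3.6.4 p.79]: "it follows from Lemma 3.5 [applied to the
submonoid `Φ ⊆ Φ^{ℝ-log}`] that the respective divisor monoids `Φ^pf`, `Φ^rlf` of `C^pf`, `C^rlf` also
satisfy the conditions of Definition 3.6, (ii)". The statement file `TemperedFrobenioidProps.lean`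
(seat abc-iut-L2-t3) records the perfection clause as the named fact `TemperedFrobenioid.Remark364`,
a conjunction of three conditions on the perf-saturation `Φ^pf ∩ Φ^{ℝ-log}` of `Φ(A)` in
`Φ^{ℝ-log}(A)`; its FIRST conjunct — "`Φ^pf` is again group-saturated in `Φ^{ℝ-log}`" — is exactly
Lemma 3.5 (ii) for `P^pf` in the §0 form `Lemma35.isGroupSaturated_perfSaturation`
(`SubmonoidPerfection.lean`) applied to the group-saturation axiom of Definition 3.6 (ii), and is
DISCHARGED here for every tempered Frobenioid (`Remark364_isGroupSaturated`). The other two conjuncts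
(perf-factoriality, through the [FrdI] vocabulary stub `V`; monoprimality of the base-field part) are
not addressed. Proof-only companion; no definitions. Seat abc-iut-L6-t12 (unit W2-L2-09).
-/

namespace Literature.AnabelianGeometry.EtaleTheta

open CategoryTheory Opposite Literature.AlgebraicGeometry.Frobenioids

universe u₀ v₀ u v w

namespace TemperedFrobenioid

variable {D₀ : Type u₀} [Category.{v₀} D₀] {V : FrdIMonoidStub.{w}}
  {T : RealifiedDivisorMonoids (D₀ := D₀) V} {D : Type u} [Category.{v} D]
  {VD : FrdICatStub.{u, v, w} D} (C₀ : TemperedFrobenioid T D VD)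

/-- **[EtTh] Remark 3.6.4, perfection clause, first condition — discharged** (p. 79): for a tempered
Frobenioid with divisor monoid `Φ ⊆ Φ^{ℝ-log}` (group-saturated by Definition 3.6 (ii)), the
perf-saturation `Φ(A)^pf ∩ Φ^{ℝ-log}(A)` — the divisor monoid of the perfection `C^pf` at `A` — is again
group-saturated in `Φ^{ℝ-log}(A)`, for every `A ∈ Ob(D)` ("it follows from Lemma 3.5", here
`Lemma35.isGroupSaturated_perfSaturation`). This is the first conjunct of the named fact
`C₀.Remark364`. [cite: MochizukiEtTh2009, Rmk 3.6.4 p.79] -/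
theorem Remark364_isGroupSaturated (A : Dᵒᵖ) :
    IsGroupSaturated (perfSaturation (C₀.Φ.carrier A)) :=
  Lemma35.isGroupSaturated_perfSaturation _ (C₀.isGroupSaturated A)

end TemperedFrobenioid

end Literature.AnabelianGeometry.EtaleTheta
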